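import Mathlib
import HarnessLib
import Summits.SmoothPoincare4.SmoothPoincare4.Theses.SmallBranchSpheres
import Summits.SmoothPoincare4.SmoothPoincare4.Theses.BachCriticalElement
import Literature.Geometry.Riemannian.WeylEnergy
import Literature.Geometry.Riemannian.ConformallyFlat
import Literature.Geometry.Riemannian.Kuiper
import Literature.Geometry.Riemannian.KuiperDevelopment
import Literature.Topology.FourManifolds.HomotopyS4Compact
import Literature.Topology.FourManifolds.HomotopyS4CompactProofs
import Literature.Topology.FourManifolds.HomotopyS4SimplyConnected
import Literature.Topology.FourManifolds.SphereSimplyConnected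

/-!
# Birth skeleton (BC3) — crux `SmallBranchSpheres.PscSpheresStandard` (stmt-SmoothPoincare4-4393)

Route `route-SmoothPoincare4-SmallBranchSpheres`, crux #3 `PscSpheresStandard` (= the target X₁ of route
`route-SmoothPoincare4-BachCriticalElement`, identical decl text, one shared ledger item): every smooth homotopy
4-sphere `M` (summit binder: `T2`, second countable, `C^∞` atlas on `ℝ⁴`, `M ≃ₕ S⁴`) carrying a Riemannian
metric with Levi-Civita connection and everywhere positive scalar curvature is diffeomorphic to `S⁴`
("Yamabe-positive homotopy 4-spheres are standard").

THE LINE = the foreseen glued split (a) of this node recorded in BOTH route files (SmallBranchSpheres: "the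
recognition half is imported unchanged from BachCriticalElement … engines there: CGY 16π²χ Weyl threshold,
Weyl-energy critical element"; BachCriticalElement, TWO-LAYER PLAN (a): "PscSpheresStandard ⇐
WeylInfimumAttained → WeylMinimiserRigidity → PscSpheresStandard (glue provable from Kuiper, proved in tree: the
attained minimiser is LCF, so M ≅ S⁴)") — the Kenig–Merle critical-element programme on the conformally
invariant Weyl energy `𝒲[g] = ∫_M |W_g|² dV_g` (`PseudoRiemannianMetric.weylEnergy`, landed definition
`Literature/Geometry/Riemannian/WeylEnergy.lean`) in the positive-scalar-curvature cone of `M`: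

* `stub_weylInfimumAttained` (E, EXISTENCE OF THE CRITICAL ELEMENT, no-bubbling form): on a smooth homotopy
  4-sphere that carries a PSC metric, the infimum of `𝒲` over all PSC metrics (Riemannian, with Levi-Civita
  connection, `scal > 0` everywhere) is ATTAINED by one of them. VERBATIM the signature of the BachCriticalElement
  item `WeylInfimumAttained` (stmt-SmoothPoincare4-5154) — `Iff.rfl` below — so one proof closes both. Open
  (crux-hard on an exotic `Σ`: minimising sequences may degenerate in the Yamabe direction or bubble with energy
  loss at `𝒲 ≥ 64π²`; Chang–Qing–Yang's Bach-flat bubble tree / ε-regularity is for critical, not minimising,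
  sequences). True on the standard `S⁴` (round metric, `𝒲 = 0`); implied by SPC4. Size XL.
* `stub_weylMinimiserRigidity` (R, THE LIOUVILLE STEP in minimal form): a PSC metric on a smooth homotopy 4-sphere
  that minimises `𝒲` among PSC metrics is locally conformally flat. VERBATIM the BachCriticalElement item
  `WeylMinimiserRigidity` (stmt-SmoothPoincare4-5104) — `Iff.rfl` below. Open (contains: a `𝒲`-minimiser in the
  PSC cone is Bach-flat where `scal > 0` is not saturated; Bach-flat + Yamabe-positive on a homotopy 4-sphere ⇒
  `W ≡ 0` — Chang–Gursky–Yang Thm A gives it below `16π²χ = 32π²`, Chang–Qing–Yang's gap theorem near it; the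
  Einstein sub-case is BachCriticalElement's crux `EinsteinRigidity`). On the standard `S⁴` it reads "a PSC metric
  with `𝒲 = 0` is LCF" (`|W|² ≡ 0` ⇒ `W = 0` ⇒ LCF in dimension 4, Weyl–Schouten). Size XL.
* `pscSpheresStandard_of_stubs : E-sig → R-sig → (PscSpheresStandard unfolded)` — THE REAL COMPOSITION,
  sorry-free: given `M`, `e : M ≃ₕ S⁴` and a PSC metric, E yields a PSC minimiser `g`, R makes it locally
  conformally flat, `M` is compact (`Literature.Topology.FourManifolds.compactSpace_of_homotopyEquiv_sphere_four_holds`,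
  PROVED in tree from singular homology) and simply connected
  (`simplyConnectedSpace_of_homotopyEquiv_sphere_four` + `simplyConnectedSpace_sphere_four_holds`, PROVED), and
  Kuiper's theorem (`Literature.Geometry.Riemannian.kuiper_four` applied to `kuiper_holds`, PROVED in tree via the
  developing map) gives `M ≃ₘ S⁴`. No third stub: the recognition of LCF homotopy 4-spheres is a tree theorem,
  not an obligation.
* `PscSpheresStandard_of : SmallBranchSpheres.PscSpheresStandard` — THE SKELETON THEOREM: the crux BY NAME from
  the two declared stubs through the composition (the `ledger skeleton check` shape: the by-name theorem takes no
  hypotheses other than registered obligations, so the implication content lives in `pscSpheresStandard_of_stubs`).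
  `PscSpheresStandard_of_bach` concludes the BachCriticalElement copy of the shared decl the same way.

`sorry` occurs ONLY in the two `stub_*` theorems.

## Disproof used

None exists: `ledger crux ls stmt-SmoothPoincare4-4393` shows no workfiles (no `Disproof.lean`, no dead lines, no
landed `Negative/` lemma) and `ledger negatives --problem SmoothPoincare4` lists 0 refuted statements
(2026-08-17). The refuter/grounder stamps on the item (2026-08-15) certify the typing this skeleton inherits: the
metric vocabulary is honest (`PseudoRiemannianMetric` a `C^∞` section, `IsRiemannian` = positive definite,
`HasLeviCivita_holds` PROVED so the `∃ _ : g.HasLeviCivita` conjunct is dischargeable, `scalarCurvature` genuine),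
`M ≃ₕ S⁴` excludes the empty manifold, compactness comes from `compactSpace_of_homotopyEquiv_sphere_four`.

## BC3 probes

For each stub `X`: `X → PscSpheresStandard` and `X → SmoothPoincare4` by `first | exact? | simpa | aesop` (plus
single-alternative and unfolded variants), files `bc/probe_*.lean` of the registrar's folder — all FAIL (recorded in
the registrar's NOTES.md and in the evidence note on the item).

## References

* S.-Y. A. Chang, M. J. Gursky, P. C. Yang, *A conformally invariant sphere theorem in four dimensions*, Publ.
  Math. IHÉS 98 (2003), Thms A/B (arXiv:math/0309287). [ChangGurskyYang2003]
* S.-Y. A. Chang, J. Qing, P. C. Yang, *On a conformal gap and finiteness theorem for a class of four-manifolds*,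
  GAFA 17 (2007), Thms A/B (arXiv:math/0508621). [ChangQingYang2007]
* C. E. Kenig, F. Merle, Invent. Math. 166 (2006) (the critical-element template). [KenigMerle2006]
* N. H. Kuiper, *On conformally-flat spaces in the large*, Ann. of Math. 50 (1949), Theorem p. 917; A. L. Besse,
  *Einstein Manifolds* (1987), Thm. 1.171. [Kuiper1949] [Besse1987]
* A. Hatcher, *Algebraic Topology* (2002), Prop. 3.29, Prop. 1.14. [HatcherAT2002]
-/

-- `Summit.<Summit>.<Problem>`: single-conjunct summit, the duplicate component is mandated (CONVENTIONS §2).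
set_option linter.dupNamespace false
set_option linter.unusedVariables false

noncomputable section

namespace Summit.SmoothPoincare4.SmoothPoincare4.Cruxes.PscSpheresStandard.Birth

open scoped Manifold ContDiff ContinuousMap Topology ENNReal
open Literature.Geometry.Lorentzian Literature.Geometry.Riemannian Literature.Topology.FourManifolds

/-! ## The two registered stubs (summit binder; vocabulary: `PseudoRiemannianMetric`, `HasLeviCivita`,
`IsRiemannian`, `scalarCurvature` of `Literature/Geometry/Lorentzian`, `weylEnergy : ℝ≥0∞` of
`Literature/Geometry/Riemannian/WeylEnergy.lean`, `IsLocallyConformallyFlat` of `ConformallyFlat.lean`) -/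

/-- **Stub E `stub_weylInfimumAttained` — existence of the critical element (no-bubbling form).** On a smooth
homotopy 4-sphere `M` (summit binder) carrying a Riemannian metric with Levi-Civita connection and everywhere
positive scalar curvature, the infimum of the Weyl energy `𝒲[g] = ∫_M |W_g|² dV_g` over all such PSC metrics is
attained by one of them. Verbatim the signature of `BachCriticalElement.WeylInfimumAttained`
(stmt-SmoothPoincare4-5154). Why plausibly true: on the standard `S⁴` the round metric has `𝒲 = 0 = min`; on an
exotic `Σ` it is the Kenig–Merle existence step (threshold `32π² < 𝒲_inf`, Chang–Qing–Yang compactness in the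
window `𝒲 < 64π²`). Open; size XL. [ChangQingYang2007, Thms A/B] [KenigMerle2006] [ChangGurskyYang2003, Thm A] -/
theorem stub_weylInfimumAttained :
    ∀ (M : Type) [TopologicalSpace M] [T2Space M] [SecondCountableTopology M] [ChartedSpace (EuclideanSpace ℝ (Fin 4)) M] [IsManifold (𝓡 4) ∞ M], M ≃ₕ Metric.sphere (0 : EuclideanSpace ℝ (Fin 5)) 1 → (∃ g : Literature.Geometry.Lorentzian.PseudoRiemannianMetric (𝓡 4) ∞ (EuclideanSpace ℝ (Fin 4)) (TangentSpace (𝓡 4) : M → Type _), ∃ _ : g.HasLeviCivita, g.IsRiemannian ∧ ∀ x, 0 < g.scalarCurvature x) → ∃ g : Literature.Geometry.Lorentzian.PseudoRiemannianMetric (𝓡 4) ∞ (EuclideanSpace ℝ (Fin 4)) (TangentSpace (𝓡 4) : M → Type _), ∃ _ : g.HasLeviCivita, g.IsRiemannian ∧ (∀ x, 0 < g.scalarCurvature x) ∧ ∀ (g' : Literature.Geometry.Lorentzian.PseudoRiemannianMetric (𝓡 4) ∞ (EuclideanSpace ℝ (Fin 4)) (TangentSpace (𝓡 4) : M → Type _))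 [g'.HasLeviCivita], g'.IsRiemannian → (∀ x, 0 < g'.scalarCurvature x) → g.weylEnergy ≤ g'.weylEnergy := by
  sorry

/-- **Stub R `stub_weylMinimiserRigidity` — the Liouville step in minimal form.** On a smooth homotopy 4-sphere `M`
(summit binder), a Riemannian metric `g` with Levi-Civita connection and `scal_g > 0` everywhere that minimises
the Weyl energy among all such PSC metrics on `M` is locally conformally flat. Verbatim the signature of
`BachCriticalElement.WeylMinimiserRigidity` (stmt-SmoothPoincare4-5104). Why plausibly true: a PSC-cone
minimiser is Bach-flat (first variation of `𝒲`, `scal > 0` an open condition), and Bach-flat Yamabe-positive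
metrics on a homotopy 4-sphere should be conformally round (Chang–Gursky–Yang Thm A below `𝒲 = 32π²`,
Chang–Qing–Yang gap theorem near it, Einstein sub-case = BachCriticalElement's `EinsteinRigidity`); on the
standard `S⁴` a minimiser has `𝒲 = 0`, i.e. `W ≡ 0`, i.e. LCF (Weyl–Schouten, dimension 4). Open; size XL.
[ChangGurskyYang2003, Thms A/B] [ChangQingYang2007, Thm A] [Besse1987, 4.76–4.79] -/
theorem stub_weylMinimiserRigidity :
    ∀ (M : Type) [TopologicalSpace M] [T2Space M] [SecondCountableTopology M] [ChartedSpace (EuclideanSpace ℝ (Fin 4)) M] [IsManifold (𝓡 4) ∞ M], M ≃ₕ Metric.sphere (0 : EuclideanSpace ℝ (Fin 5)) 1 → ∀ (g : Literature.Geometry.Lorentzian.PseudoRiemannianMetric (𝓡 4) ∞ (EuclideanSpace ℝ (Fin 4)) (TangentSpace (𝓡 4) : M → Type _)) [g.HasLeviCivita], g.IsRiemannian → (∀ x, 0 < g.scalarCurvature x) → (∀ (g' : Literature.Geometry.Lorentzian.PseudoRiemannianMetric (𝓡 4) ∞ (EuclideanSpace ℝ (Fin 4)) (TangentSpace (𝓡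 4) : M → Type _)) [g'.HasLeviCivita], g'.IsRiemannian → (∀ x, 0 < g'.scalarCurvature x) → g.weylEnergy ≤ g'.weylEnergy) → g.IsLocallyConformallyFlat := by
  sorry

/-! ## Identity with the BachCriticalElement items (shared work: one proof closes both spellings) -/

example : (∀ (M : Type) [TopologicalSpace M] [T2Space M] [SecondCountableTopology M] [ChartedSpace (EuclideanSpace ℝ (Fin 4)) M] [IsManifold (𝓡 4) ∞ M], M ≃ₕ Metric.sphere (0 : EuclideanSpace ℝ (Fin 5)) 1 → (∃ g : Literature.Geometry.Lorentzian.PseudoRiemannianMetric (𝓡 4) ∞ (EuclideanSpace ℝ (Fin 4)) (TangentSpace (𝓡 4) : M → Type _), ∃ _ : g.HasLeviCivita, g.IsRiemannian ∧ ∀ x, 0 < g.scalarCurvature x) → ∃ g : Literature.Geometry.Lorentzian.PseudoRiemannianMetric (𝓡 4) ∞ (EuclideanSpace ℝ (Fin 4)) (TangentSpace (𝓡 4) : M → Type _), ∃ _ : g.HasLeviCivita, g.IsRiemannian ∧ (∀ x, 0 < g.scalarCurvature x) ∧ ∀ (g' : Literature.Geometry.Lorentzian.PseudoRiemannianMetric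 (𝓡 4) ∞ (EuclideanSpace ℝ (Fin 4)) (TangentSpace (𝓡 4) : M → Type _)) [g'.HasLeviCivita], g'.IsRiemannian → (∀ x, 0 < g'.scalarCurvature x) → g.weylEnergy ≤ g'.weylEnergy)
    ↔ Summit.SmoothPoincare4.SmoothPoincare4.Theses.BachCriticalElement.WeylInfimumAttained :=
  Iff.rfl

example : (∀ (M : Type) [TopologicalSpace M] [T2Space M] [SecondCountableTopology M] [ChartedSpace (EuclideanSpace ℝ (Fin 4)) M] [IsManifold (𝓡 4) ∞ M], M ≃ₕ Metric.sphere (0 : EuclideanSpace ℝ (Fin 5)) 1 → ∀ (g : Literature.Geometry.Lorentzian.PseudoRiemannianMetric (𝓡 4) ∞ (EuclideanSpace ℝ (Fin 4)) (TangentSpace (𝓡 4) : M → Type _)) [g.HasLeviCivita], g.IsRiemannian → (∀ x, 0 < g.scalarCurvature x) → (∀ (g' : Literature.Geometry.Lorentzian.PseudoRiemannianMetric (𝓡 4) ∞ (EuclideanSpace ℝ (Fin 4)) (TangentSpace (𝓡 4) : M → Type _)) [g'.HasLeviCivita], g'.IsRiemannian → (∀ x, 0 < g'.scalarCurvature x)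 → g.weylEnergy ≤ g'.weylEnergy) → g.IsLocallyConformallyFlat)
    ↔ Summit.SmoothPoincare4.SmoothPoincare4.Theses.BachCriticalElement.WeylMinimiserRigidity :=
  Iff.rfl

/-- The two route spellings of the shared crux are one proposition. [folklore] -/
example : Summit.SmoothPoincare4.SmoothPoincare4.Theses.SmallBranchSpheres.PscSpheresStandard
    ↔ Summit.SmoothPoincare4.SmoothPoincare4.Theses.BachCriticalElement.PscSpheresStandard :=
  Iff.rfl

/-! ## The composition: E and R prove X₁ (Kuiper, compactness and simple connectivity are tree theorems) -/

/-- **Composition with explicit hypotheses** (`E-sig → R-sig → X₁`, the conclusion written as the crux's one-step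
unfolding so that `PscSpheresStandard_of` below is the file's only theorem whose head is the crux name). Proof:
given `M`, `e : M ≃ₕ S⁴` and a PSC metric, E gives a PSC metric `g` minimising `𝒲` in the PSC cone; R makes `g`
locally conformally flat; `M` is compact (`compactSpace_of_homotopyEquiv_sphere_four_holds`) and simply connected
(`simplyConnectedSpace_of_homotopyEquiv_sphere_four simplyConnectedSpace_sphere_four_holds`), so Kuiper's theorem
(`kuiper_four kuiper_holds`) yields `M ≃ₘ S⁴`. Sorry-free, standard axioms. [Kuiper1949, Theorem p. 917]
[HatcherAT2002, Prop. 3.29] -/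
theorem pscSpheresStandard_of_stubs
    (hE : ∀ (M : Type) [TopologicalSpace M] [T2Space M] [SecondCountableTopology M] [ChartedSpace (EuclideanSpace ℝ (Fin 4)) M] [IsManifold (𝓡 4) ∞ M], M ≃ₕ Metric.sphere (0 : EuclideanSpace ℝ (Fin 5)) 1 → (∃ g : Literature.Geometry.Lorentzian.PseudoRiemannianMetric (𝓡 4) ∞ (EuclideanSpace ℝ (Fin 4)) (TangentSpace (𝓡 4) : M → Type _), ∃ _ : g.HasLeviCivita, g.IsRiemannian ∧ ∀ x, 0 < g.scalarCurvature x) → ∃ g : Literature.Geometry.Lorentzian.PseudoRiemannianMetric (𝓡 4) ∞ (EuclideanSpace ℝ (Fin 4)) (TangentSpace (𝓡 4) : M → Type _), ∃ _ : g.HasLeviCivita, g.IsRiemannian ∧ (∀ x, 0 < g.scalarCurvature x) ∧ ∀ (g' : Literature.Geometry.Lorentzian.PseudoRiemannianMetric (𝓡 4) ∞ (EuclideanSpace ℝ (Fin 4)) (TangentSpace (𝓡 4) : M → Type _)) [g'.HasLeviCivita], g'.IsRiemannian → (∀ x, 0 < g'.scalarCurvature x) → g.weylEnergy ≤ g'.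weylEnergy)
    (hR : ∀ (M : Type) [TopologicalSpace M] [T2Space M] [SecondCountableTopology M] [ChartedSpace (EuclideanSpace ℝ (Fin 4)) M] [IsManifold (𝓡 4) ∞ M], M ≃ₕ Metric.sphere (0 : EuclideanSpace ℝ (Fin 5)) 1 → ∀ (g : Literature.Geometry.Lorentzian.PseudoRiemannianMetric (𝓡 4) ∞ (EuclideanSpace ℝ (Fin 4)) (TangentSpace (𝓡 4) : M → Type _)) [g.HasLeviCivita], g.IsRiemannian → (∀ x, 0 < g.scalarCurvature x) → (∀ (g' : Literature.Geometry.Lorentzian.PseudoRiemannianMetric (𝓡 4) ∞ (EuclideanSpace ℝ (Fin 4)) (TangentSpace (𝓡 4) : M → Type _)) [g'.HasLeviCivita], g'.IsRiemannian → (∀ x, 0 < g'.scalarCurvature x) → g.weylEnergy ≤ g'.weylEnergy) → g.IsLocallyConformallyFlat) :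
    ∀ (M : Type) [TopologicalSpace M] [T2Space M] [SecondCountableTopology M]
      [ChartedSpace (EuclideanSpace ℝ (Fin 4)) M] [IsManifold (𝓡 4) ∞ M],
      M ≃ₕ Metric.sphere (0 : EuclideanSpace ℝ (Fin 5)) 1 →
      (∃ g : Literature.Geometry.Lorentzian.PseudoRiemannianMetric (𝓡 4) ∞ (EuclideanSpace ℝ (Fin 4))
          (TangentSpace (𝓡 4) : M → Type _), ∃ _ : g.HasLeviCivita, g.IsRiemannian ∧ ∀ x, 0 < g.scalarCurvature x) →
      Nonempty (M ≃ₘ⟮𝓡 4, 𝓡 4⟯ Metric.sphere (0 : EuclideanSpace ℝ (Fin 5)) 1) := by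
  intro M _ _ _ _ _ e hpsc
  -- E: a PSC metric minimising the Weyl energy in the PSC cone
  obtain ⟨g, hLC, hRiem, hpos, hmin⟩ := hE M e hpsc
  haveI : g.HasLeviCivita := hLC
  -- R: the minimiser is locally conformally flat
  have hlcf : g.IsLocallyConformallyFlat := hR M e g hRiem hpos (fun g' _ hRiem' hpos' => hmin g' hRiem' hpos')
  -- topology of the homotopy 4-sphere (tree theorems)
  haveI : CompactSpace M := compactSpace_of_homotopyEquiv_sphere_four_holds M e
  haveI : SimplyConnectedSpace M :=
    simplyConnectedSpace_of_homotopyEquiv_sphere_four simplyConnectedSpace_sphere_four_holds M e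
  -- Kuiper (tree theorem)
  exact kuiper_four kuiper_holds M g hRiem hlcf

/-- **THE SKELETON THEOREM.** The crux `Summit.SmoothPoincare4.SmoothPoincare4.Theses.SmallBranchSpheres.PscSpheresStandard`,
concluded BY NAME from the two DECLARED stubs `stub_weylInfimumAttained`, `stub_weylMinimiserRigidity` (the only
`sorry`s of the file) through the sorry-free composition `pscSpheresStandard_of_stubs`. [folklore] -/
theorem PscSpheresStandard_of :
    Summit.SmoothPoincare4.SmoothPoincare4.Theses.SmallBranchSpheres.PscSpheresStandard :=
  pscSpheresStandard_of_stubs stub_weylInfimumAttained stub_weylMinimiserRigidity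

/-- The same skeleton concludes the BachCriticalElement spelling of the shared crux (route
`route-SmoothPoincare4-BachCriticalElement`, target X₁) by name. [folklore] -/
theorem PscSpheresStandard_of_bach :
    Summit.SmoothPoincare4.SmoothPoincare4.Theses.BachCriticalElement.PscSpheresStandard :=
  pscSpheresStandard_of_stubs stub_weylInfimumAttained stub_weylMinimiserRigidity

end Summit.SmoothPoincare4.SmoothPoincare4.Cruxes.PscSpheresStandard.Birth

end
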